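import Mathlib
import HarnessLib
import Summits.NavierStokesRegularity.NavierStokesRegularity.Theorems.PoloidalWindowDoorPoloidalWindowRigidityMovingBallMaxPrinciple

/-!
# Route `PoloidalWindowDoor`, crux `PoloidalWindowRigidity` (K2, stmt-NavierStokesRegularity-19708) — kernel tool:
# the LOCAL parabolic strong maximum principle (cylinders), for charts and near-peak arguments

Cell ns-regularity-ideate, seat nsreg-p7 gen 5 (third worker under the K2 lead; file landed
`--supports stmt-NavierStokesRegularity-19708`).  The whole-slab strong maximum principle of `…StrongMaxPrinciple`
(p481746) asks the sub-solution inequality on all of `[t₀, T] × ℝ³`.  The arguments of the K2 programme that need a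
strong principle are LOCAL: the Clebsch-slope law of K2P1-S2-NOTES §4 holds only on `{ω ≠ 0}` (a chart), and the
«near-peak» sharpening of M10 (companion file `…NearPeakCriticalProduction`) has its sub-solution inequality only where
the scale-invariant enstrophy is close to its supremum.  This file localises the principle to a parabolic CYLINDER
`[t₀, T] × B̄(x₀, ρ)`:

* `lt_of_gap_on_ball_local` — the ray lemma with hypotheses only on the moving ball;
* `strongMaximumPrinciple_local` — if `∂ₜw + Dw(b) − Δw ≤ 0` and `w ≤ M` on the cylinder (law in the open
  cylinder, drift bounded there) and `w(t⋆, x⋆) = M` with `t⋆ ∈ (t₀, T]`, `x⋆ ∈ B(x₀, ρ)`, then `w ≡ M` on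
  `[t₀, t⋆) × B(x₀, ρ)` (tubes around the segment from `(t, x)` to `(t⋆, x⋆)` stay in the cylinder by convexity);
* `dissipation_eq_zero_of_max_local` — with a dissipation term `D ≥ 0` in the law, `D ≡ 0` on
  `(t₀, t⋆) × B(x₀, ρ)` (local constancy ⇒ `∂ₜw = 0`, `Dw = 0`, `Δw = 0` via `laplacian_congr_nhds`).

WHAT THIS IS NOT: not a claim about Navier–Stokes — a linear parabolic lemma (bears_on LADDER-NS N0, route
PoloidalWindowDoor, crux K2).
-/

noncomputable section

-- the summit and its single sub-problem share the name (CONVENTIONS §1), as in every Theorems file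
set_option linter.dupNamespace false

namespace Summit.NavierStokesRegularity.NavierStokesRegularity.Theorems.PoloidalWindowDoorPoloidalWindowRigidityLocalStrongMaxPrinciple

open MeasureTheory Set Function Filter Topology TopologicalSpace Metric InnerProductSpace
open scoped RealInnerProductSpace InnerProductSpace Laplacian ContDiff
open Literature.Analysis Literature.Analysis.FluidPDE
open Summit.NavierStokesRegularity.NavierStokesRegularity.Theorems.PoloidalWindowDoorPoloidalWindowRigidityMovingBallMaxPrinciple

/-! ### The ray lemma with local hypotheses -/

/-- **Strict sub-maximality propagates along a ray — LOCAL form.**  Same as `…StrongMaxPrinciple.lt_of_gap_on_ball`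
(p481746) but every hypothesis on the sub-solution `w` (law, bound `w ≤ M`, drift bound) is asked only on the closed
moving ball `{‖x − (x₁ + (t − t₁)ξ)‖ ≤ r, t ∈ [t₁, T]}` (the law only in its interior, the bound only on the moving
sphere); regularity (`C²` slices, time derivative, joint continuity) is kept global in `x` for simplicity.  Conclusion:
a gap `w(t₁, ·) ≤ M − γ` on `B̄(x₁, r)` gives `w(t, x₁ + (t − t₁)ξ) < M` for `t ∈ (t₁, T]`.
[cite: Lieberman1996, Ch. II Thm. 2.7 (proof)] -/
theorem lt_of_gap_on_ball_local {b : ℝ → EuclideanSpace ℝ (Fin 3) → EuclideanSpace ℝ (Fin 3)} {A M : ℝ}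
    {w wt : ℝ → EuclideanSpace ℝ (Fin 3) → ℝ} {t₁ T : ℝ} (h1T : t₁ < T)
    {x₁ ξ : EuclideanSpace ℝ (Fin 3)} {r γ : ℝ} (hr : 0 < r) (hγ : 0 < γ)
    (hbA : ∀ t ∈ Icc t₁ T, ∀ x, ‖x - (x₁ + (t - t₁) • ξ)‖ ≤ r → ‖b t x‖ ≤ A)
    (hw_c : ContinuousOn (uncurry w) (Icc t₁ T ×ˢ univ))
    (hw2 : ∀ t ∈ Icc t₁ T, ContDiff ℝ 2 (w t))
    (hwt : ∀ x, ∀ t ∈ Icc t₁ T, HasDerivAt (fun τ => w τ x) (wt t x) t)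
    (hlaw : ∀ t ∈ Ioc t₁ T, ∀ x, ‖x - (x₁ + (t - t₁) • ξ)‖ < r →
      wt t x + fderiv ℝ (w t) x (b t x) - (Δ (w t)) x ≤ 0)
    (hle : ∀ t ∈ Icc t₁ T, ∀ x, ‖x - (x₁ + (t - t₁) • ξ)‖ = r → w t x ≤ M)
    (hgap : ∀ x, ‖x - x₁‖ ≤ r → w t₁ x ≤ M - γ) :
    ∀ t ∈ Ioc t₁ T, w t (x₁ + (t - t₁) • ξ) < M := by
  have hA0 : 0 ≤ A := (norm_nonneg _).trans (hbA t₁ ⟨le_rfl, h1T.le⟩ x₁ (by simp [hr.le]))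
  -- the constants of the barrier
  set B : ℝ := 4 * r * (A + ‖ξ‖) + 20 with hB
  set Λ : ℝ := B ^ 2 / (32 * r ^ 2) with hΛ
  have hΛeq : B ^ 2 ≤ 32 * Λ * r ^ 2 := by
    rw [hΛ]; field_simp; exact le_rfl
  set δ : ℝ := γ / r ^ 4 with hδ
  have hδ0 : 0 < δ := by rw [hδ]; positivity
  -- the barrier and the comparison function
  set η : ℝ → EuclideanSpace ℝ (Fin 3) → ℝ := fun t x =>
    δ * Real.exp (-Λ * (t - t₁)) * (r ^ 2 - ‖x - (x₁ + (t - t₁) • ξ)‖ ^ 2) ^ 2 with hηdef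
  set ηt : ℝ → EuclideanSpace ℝ (Fin 3) → ℝ := fun t x =>
    δ * Real.exp (-Λ * (t - t₁)) *
      (-Λ * (r ^ 2 - ‖x - (x₁ + (t - t₁) • ξ)‖ ^ 2) ^ 2 +
        4 * (r ^ 2 - ‖x - (x₁ + (t - t₁) • ξ)‖ ^ 2) * ⟪x - (x₁ + (t - t₁) • ξ), ξ⟫_ℝ) with hηtdef
  set u : ℝ → EuclideanSpace ℝ (Fin 3) → ℝ := fun t x => w t x - M + η t x with hudef
  set ut : ℝ → EuclideanSpace ℝ (Fin 3) → ℝ := fun t x => wt t x + ηt t x with hutdef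
  -- regularity of `η`
  have hη_cont : Continuous (uncurry η) := by
    have h1 : Continuous fun p : ℝ × EuclideanSpace ℝ (Fin 3) => p.2 - (x₁ + (p.1 - t₁) • ξ) :=
      continuous_snd.sub (continuous_const.add ((continuous_fst.sub continuous_const).smul continuous_const))
    have h2 : Continuous fun p : ℝ × EuclideanSpace ℝ (Fin 3) => Real.exp (-Λ * (p.1 - t₁)) :=
      (continuous_const.mul (continuous_fst.sub continuous_const)).rexp
    exact (continuous_const.mul h2).mul ((continuous_const.sub (h1.norm.pow 2)).pow 2)
  have hη2 : ∀ t, ContDiff ℝ 2 (η t) := fun t =>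
    contDiff_bump (δ * Real.exp (-Λ * (t - t₁))) r (x₁ + (t - t₁) • ξ)
  have hηt : ∀ x t, HasDerivAt (fun τ => η τ x) (ηt t x) t := fun x t =>
    hasDerivAt_movingBump δ Λ r t₁ x x₁ ξ t
  -- hypotheses of the moving-ball maximum principle for `u` on `[t₁, T]`
  have hu_c : ContinuousOn (uncurry u) (Icc t₁ T ×ˢ univ) := by
    have h2 : ContinuousOn (fun p : ℝ × EuclideanSpace ℝ (Fin 3) => uncurry w p - M + uncurry η p)
        (Icc t₁ T ×ˢ univ) := (hw_c.sub continuousOn_const).add hη_cont.continuousOn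
    exact h2.congr fun p _ => rfl
  have hu2 : ∀ t ∈ Icc t₁ T, ContDiff ℝ 2 (u t) := fun t ht =>
    ((hw2 t ht).sub contDiff_const).add (hη2 t)
  have hut : ∀ x, ∀ t ∈ Icc t₁ T, HasDerivAt (fun τ => u τ x) (ut t x) t := fun x t ht =>
    ((hwt x t ht).sub_const M).add (hηt x t)
  have hlaw_u : ∀ t ∈ Ioc t₁ T, ∀ x, ‖x - (x₁ + (t - t₁) • ξ)‖ < r →
      ut t x + fderiv ℝ (u t) x (b t x) - (Δ (u t)) x ≤ 0 := by
    intro t ht x hx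
    have htI : t ∈ Icc t₁ T := ⟨ht.1.le, ht.2⟩
    have hwd : DifferentiableAt ℝ (w t) x := (hw2 t htI).differentiable two_ne_zero x
    have hηd : DifferentiableAt ℝ (η t) x := (hη2 t).differentiable two_ne_zero x
    have hD : fderiv ℝ (u t) x = fderiv ℝ (w t) x + fderiv ℝ (η t) x := by
      have h1 : u t = fun y => (w t y - M) + η t y := by funext y; simp [hudef]
      rw [h1, fderiv_fun_add (hwd.sub_const M) hηd, fderiv_sub_const]
    have hL : (Δ (u t)) x = (Δ (w t)) x + (Δ (η t)) x := by
      have h1 : u t = (fun y => w t y - M) + η t := by funext y; simp [hudef]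
      have h2 : (fun y => w t y - M) = (w t) - fun _ => M := by funext y; simp
      rw [h1, ((hw2 t htI).sub contDiff_const).contDiffAt.laplacian_add (hη2 t).contDiffAt, h2,
        (hw2 t htI).contDiffAt.laplacian_sub contDiffAt_const, laplacian_const]
      simp
    have hηlaw : ηt t x + fderiv ℝ (η t) x (b t x) - (Δ (η t)) x ≤ 0 :=
      movingBump_law hδ0.le hr (hbA t htI x hx.le) hΛeq hx.le
    have hwlaw := hlaw t ht x hx
    simp only [hutdef, hD, hL, add_apply]
    linarith
  have hbot : ∀ x, ‖x - x₁‖ ≤ r → u t₁ x ≤ 0 := by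
    intro x hx
    have h1 : η t₁ x = δ * (r ^ 2 - ‖x - x₁‖ ^ 2) ^ 2 := by simp [hηdef]
    have h2 : (r ^ 2 - ‖x - x₁‖ ^ 2) ^ 2 ≤ (r ^ 2) ^ 2 := by
      have h3 : 0 ≤ r ^ 2 - ‖x - x₁‖ ^ 2 := sub_nonneg.2 (pow_le_pow_left₀ (norm_nonneg _) hx 2)
      have h4 : r ^ 2 - ‖x - x₁‖ ^ 2 ≤ r ^ 2 := sub_le_self _ (sq_nonneg _)
      exact pow_le_pow_left₀ h3 h4 2
    have h5 : δ * (r ^ 2) ^ 2 = γ := by rw [hδ]; field_simp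
    have h6 : η t₁ x ≤ γ := by
      rw [h1, ← h5]; exact mul_le_mul_of_nonneg_left h2 hδ0.le
    have h7 := hgap x hx
    simp only [hudef]
    linarith
  have hside : ∀ t ∈ Icc t₁ T, ∀ x, ‖x - (x₁ + (t - t₁) • ξ)‖ = r → u t x ≤ 0 := by
    intro t ht x hx
    have h1 : η t x = 0 := by simp [hηdef, hx]
    have h2 := hle t ht x hx
    simp only [hudef, h1, add_zero, sub_nonpos]
    exact h2
  have hmp := movingBall_maxPrinciple (b := b) h1T.le x₁ ξ hu_c hu2 hut hlaw_u hbot hside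
  -- evaluate at the moving centre
  intro t ht
  have htI : t ∈ Icc t₁ T := ⟨ht.1.le, ht.2⟩
  have h1 := hmp t htI (x₁ + (t - t₁) • ξ) (by simp [hr.le])
  have h2 : η t (x₁ + (t - t₁) • ξ) = δ * Real.exp (-Λ * (t - t₁)) * (r ^ 2) ^ 2 := by simp [hηdef]
  have h3 : 0 < δ * Real.exp (-Λ * (t - t₁)) * (r ^ 2) ^ 2 := by positivity
  simp only [hudef] at h1
  linarith

/-! ### The local strong maximum principle on a cylinder -/

/-- Convexity bookkeeping: the point `x + s (x⋆ − x)`, `s ∈ [0,1]`, of the segment from `x` to `x⋆` is within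
`max ‖x − x₀‖ ‖x⋆ − x₀‖` of `x₀`. [folklore] -/
theorem norm_segment_sub_le {x xs x₀ : EuclideanSpace ℝ (Fin 3)} {s : ℝ} (hs0 : 0 ≤ s) (hs1 : s ≤ 1) :
    ‖x + s • (xs - x) - x₀‖ ≤ max ‖x - x₀‖ ‖xs - x₀‖ := by
  have h : x + s • (xs - x) - x₀ = (1 - s) • (x - x₀) + s • (xs - x₀) := by
    simp only [smul_sub, sub_smul, one_smul]; abel
  rw [h]
  calc ‖(1 - s) • (x - x₀) + s • (xs - x₀)‖ ≤ ‖(1 - s) • (x - x₀)‖ + ‖s • (xs - x₀)‖ := norm_add_le _ _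
    _ = (1 - s) * ‖x - x₀‖ + s * ‖xs - x₀‖ := by
        rw [norm_smul, norm_smul, Real.norm_of_nonneg (by linarith), Real.norm_of_nonneg hs0]
    _ ≤ (1 - s) * max ‖x - x₀‖ ‖xs - x₀‖ + s * max ‖x - x₀‖ ‖xs - x₀‖ :=
        add_le_add (mul_le_mul_of_nonneg_left (le_max_left _ _) (by linarith))
          (mul_le_mul_of_nonneg_left (le_max_right _ _) hs0)
    _ = max ‖x - x₀‖ ‖xs - x₀‖ := by ring

/-- **LOCAL parabolic strong maximum principle on a cylinder.**  On `[t₀, T] × B̄(x₀, ρ)`: a classical sub-solution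
`w` of `∂ₜw + Dw(b) − Δw ≤ 0` in the open cylinder `(t₀, T] × B(x₀, ρ)` (regularity global in `x`: joint continuity on
`[t₀,T] × ℝ³`, `C²` slices, classical time derivative), drift bounded by `A` and `w ≤ M` on the closed cylinder, which
attains `M` at `(t⋆, x⋆)` with `t⋆ ∈ (t₀, T]`, `x⋆ ∈ B(x₀, ρ)`, is identically `M` on `[t₀, t⋆) × B(x₀, ρ)`.
[cite: Lieberman1996, Ch. II Thm. 2.7] -/
theorem strongMaximumPrinciple_local {b : ℝ → EuclideanSpace ℝ (Fin 3) → EuclideanSpace ℝ (Fin 3)} {A M : ℝ}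
    {w wt : ℝ → EuclideanSpace ℝ (Fin 3) → ℝ} {t₀ T ρ : ℝ} {x₀ : EuclideanSpace ℝ (Fin 3)}
    (hbA : ∀ t ∈ Icc t₀ T, ∀ x, ‖x - x₀‖ ≤ ρ → ‖b t x‖ ≤ A)
    (hw_c : ContinuousOn (uncurry w) (Icc t₀ T ×ˢ univ))
    (hw2 : ∀ t ∈ Icc t₀ T, ContDiff ℝ 2 (w t))
    (hwt : ∀ x, ∀ t ∈ Icc t₀ T, HasDerivAt (fun τ => w τ x) (wt t x) t)
    (hlaw : ∀ t ∈ Ioc t₀ T, ∀ x, ‖x - x₀‖ < ρ → wt t x + fderiv ℝ (w t) x (b t x) - (Δ (w t)) x ≤ 0)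
    (hle : ∀ t ∈ Icc t₀ T, ∀ x, ‖x - x₀‖ ≤ ρ → w t x ≤ M)
    {ts : ℝ} (hts : ts ∈ Ioc t₀ T) {xs : EuclideanSpace ℝ (Fin 3)} (hxs : ‖xs - x₀‖ < ρ) (hmax : w ts xs = M) :
    ∀ t ∈ Ico t₀ ts, ∀ x, ‖x - x₀‖ < ρ → w t x = M := by
  intro t ht x hx
  by_contra hne
  have htI : t ∈ Icc t₀ T := ⟨ht.1, ht.2.le.trans hts.2⟩
  have hlt : w t x < M := lt_of_le_of_ne (hle t htI x hx.le) hne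
  -- the margin to the boundary of the cylinder along the segment `[x, xs]`
  set m : ℝ := max ‖x - x₀‖ ‖xs - x₀‖ with hm
  have hmρ : m < ρ := max_lt hx hxs
  -- a gap on a small closed ball around `x` at time `t`
  set γ : ℝ := (M - w t x) / 2 with hγ
  have hγ0 : 0 < γ := by rw [hγ]; linarith
  obtain ⟨r₀, hr₀, hgap₀⟩ : ∃ r₀ > 0, ∀ x', ‖x' - x‖ ≤ r₀ → w t x' ≤ M - γ := by
    have hc : ContinuousAt (w t) x := (hw2 t htI).continuous.continuousAt
    have hev : ∀ᶠ x' in 𝓝 x, w t x' < w t x + γ := hc.eventually (gt_mem_nhds (by linarith))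
    rw [Metric.eventually_nhds_iff] at hev
    obtain ⟨ε, hε, h⟩ := hev
    refine ⟨ε / 2, by positivity, fun x' hx' => ?_⟩
    have h1 : dist x' x < ε := by rw [dist_eq_norm]; linarith
    have h2 := h h1
    rw [hγ]; linarith
  set r : ℝ := min r₀ ((ρ - m) / 2) with hr
  have hr0 : 0 < r := lt_min hr₀ (by linarith)
  have hrr₀ : r ≤ r₀ := min_le_left _ _
  have hrm : m + r < ρ := by
    have : r ≤ (ρ - m) / 2 := min_le_right _ _
    linarith
  have hgap : ∀ x', ‖x' - x‖ ≤ r → w t x' ≤ M - γ := fun x' hx' => hgap₀ x' (hx'.trans hrr₀)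
  -- the ray from `(t, x)` to `(ts, xs)`; its tube of radius `r` stays inside the cylinder
  have hst : 0 < ts - t := sub_pos.2 ht.2
  set ξ : EuclideanSpace ℝ (Fin 3) := (ts - t)⁻¹ • (xs - x) with hξ
  have htube : ∀ τ ∈ Icc t ts, ∀ y, ‖y - (x + (τ - t) • ξ)‖ ≤ r → ‖y - x₀‖ < ρ := by
    intro τ hτ y hy
    have hs0 : 0 ≤ (τ - t) * (ts - t)⁻¹ := mul_nonneg (by linarith [hτ.1]) (inv_nonneg.2 hst.le)
    have hs1 : (τ - t) * (ts - t)⁻¹ ≤ 1 := by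
      rw [mul_inv_le_iff₀ hst]; linarith [hτ.2]
    have hc : ‖x + (τ - t) • ξ - x₀‖ ≤ m := by
      have e : (τ - t) • ξ = ((τ - t) * (ts - t)⁻¹) • (xs - x) := by rw [hξ, smul_smul]
      rw [e]; exact norm_segment_sub_le hs0 hs1
    calc ‖y - x₀‖ = ‖(y - (x + (τ - t) • ξ)) + (x + (τ - t) • ξ - x₀)‖ := by congr 1; abel
      _ ≤ ‖y - (x + (τ - t) • ξ)‖ + ‖x + (τ - t) • ξ - x₀‖ := norm_add_le _ _
      _ ≤ r + m := add_le_add hy hc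
      _ < ρ := by linarith
  have hsub : Icc t ts ⊆ Icc t₀ T := Icc_subset_Icc ht.1 hts.2
  have h := lt_of_gap_on_ball_local (b := b) (A := A) (M := M) (w := w) (wt := wt) ht.2 hr0 hγ0
    (fun τ hτ y hy => hbA τ (hsub hτ) y (htube τ hτ y hy).le)
    (hw_c.mono (prod_mono hsub le_rfl)) (fun τ hτ => hw2 τ (hsub hτ)) (fun y τ hτ => hwt y τ (hsub hτ))
    (fun τ hτ y hy => hlaw τ ⟨ht.1.trans_lt hτ.1, hτ.2.trans hts.2⟩ y (htube τ ⟨hτ.1.le, hτ.2⟩ y hy.le))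
    (fun τ hτ y hy => hle τ (hsub hτ) y (htube τ hτ y hy.le).le) hgap ts ⟨ht.2, le_rfl⟩
  have hpt : x + (ts - t) • ξ = xs := by
    rw [hξ, smul_smul, mul_inv_cancel₀ hst.ne', one_smul, add_sub_cancel]
  rw [hpt, hmax] at h
  exact lt_irrefl _ h

/-- **Dissipation bookkeeping, local form.**  In the setting of `strongMaximumPrinciple_local`, if the law in the open
cylinder carries a nonnegative dissipation, `∂ₜw + Dw(b) − Δw ≤ −D`, `D ≥ 0`, then `D ≡ 0` on
`(t₀, t⋆) × B(x₀, ρ)` (there `w ≡ M` locally, so `∂ₜw`, `Dw`, `Δw` vanish). [folklore] -/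
theorem dissipation_eq_zero_of_max_local {b : ℝ → EuclideanSpace ℝ (Fin 3) → EuclideanSpace ℝ (Fin 3)} {A M : ℝ}
    {w wt D : ℝ → EuclideanSpace ℝ (Fin 3) → ℝ} {t₀ T ρ : ℝ} {x₀ : EuclideanSpace ℝ (Fin 3)}
    (hbA : ∀ t ∈ Icc t₀ T, ∀ x, ‖x - x₀‖ ≤ ρ → ‖b t x‖ ≤ A)
    (hw_c : ContinuousOn (uncurry w) (Icc t₀ T ×ˢ univ))
    (hw2 : ∀ t ∈ Icc t₀ T, ContDiff ℝ 2 (w t))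
    (hwt : ∀ x, ∀ t ∈ Icc t₀ T, HasDerivAt (fun τ => w τ x) (wt t x) t)
    (hD0 : ∀ t ∈ Ioc t₀ T, ∀ x, ‖x - x₀‖ < ρ → 0 ≤ D t x)
    (hlawD : ∀ t ∈ Ioc t₀ T, ∀ x, ‖x - x₀‖ < ρ → wt t x + fderiv ℝ (w t) x (b t x) - (Δ (w t)) x ≤ -D t x)
    (hle : ∀ t ∈ Icc t₀ T, ∀ x, ‖x - x₀‖ ≤ ρ → w t x ≤ M)
    {ts : ℝ} (hts : ts ∈ Ioc t₀ T) {xs : EuclideanSpace ℝ (Fin 3)} (hxs : ‖xs - x₀‖ < ρ) (hmax : w ts xs = M) :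
    ∀ t ∈ Ioo t₀ ts, ∀ x, ‖x - x₀‖ < ρ → D t x = 0 := by
  have hlaw : ∀ t ∈ Ioc t₀ T, ∀ x, ‖x - x₀‖ < ρ → wt t x + fderiv ℝ (w t) x (b t x) - (Δ (w t)) x ≤ 0 :=
    fun t ht x hx => (hlawD t ht x hx).trans (neg_nonpos.2 (hD0 t ht x hx))
  have hS := strongMaximumPrinciple_local hbA hw_c hw2 hwt hlaw hle hts hxs hmax
  intro t ht x hx
  have htI : t ∈ Icc t₀ T := ⟨ht.1.le, ht.2.le.trans hts.2⟩
  have htI' : t ∈ Ioc t₀ T := ⟨ht.1, ht.2.le.trans hts.2⟩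
  -- the slice `w t` is locally the constant `M` near `x`
  have hball : {y : EuclideanSpace ℝ (Fin 3) | ‖y - x₀‖ < ρ} ∈ 𝓝 x :=
    (isOpen_lt (continuous_id.sub continuous_const).norm continuous_const).mem_nhds hx
  have hslice : (w t) =ᶠ[𝓝 x] fun _ => M := by
    filter_upwards [hball] with y hy
    exact hS t ⟨ht.1.le, ht.2⟩ y hy
  have hD : fderiv ℝ (w t) x = 0 := by rw [hslice.fderiv_eq]; simp
  have hL : (Δ (w t)) x = 0 := by
    rw [(laplacian_congr_nhds hslice).eq_of_nhds, laplacian_const]; simp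
  -- the time derivative vanishes
  have hev : (fun τ => w τ x) =ᶠ[𝓝 t] fun _ => M := by
    filter_upwards [Ioo_mem_nhds ht.1 ht.2] with τ hτ
    exact hS τ ⟨hτ.1.le, hτ.2⟩ x hx
  have h0 : HasDerivAt (fun τ => w τ x) 0 t := (hasDerivAt_const t M).congr_of_eventuallyEq hev
  have hwt0 : wt t x = 0 := (hwt x t htI).unique h0
  have h := hlawD t htI' x hx
  rw [hwt0, hD, hL] at h
  simp only [zero_apply, add_zero, sub_zero] at h
  linarith [hD0 t htI' x hx]

end Summit.NavierStokesRegularity.NavierStokesRegularity.Theorems.PoloidalWindowDoorPoloidalWindowRigidityLocalStrongMaxPrinciple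

end
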